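/-
Origin: expansion seat `planner-pub-hodgecm-pv14-0`, handover 2026-08-18 (`HOME/pub-hodgecm-pv14/lean/Pv14/PerL34/P43X1Bridge.lean`, md5 3ddb9ced, 105 lines);
landed by the gen-6 packager in gate run 22 as `HodgeCM/PerL34/P43_X1bridge.lean` (verbatim).
-/
/-
Origin: HOME/pub-hodgecm-pv14/lean/Pv14/PerL34/P43X1Bridge.lean — session planner-pub-hodgecm-pv14-0 (unit pub-hodgecm-pv14,
node N33b holder).  Intended final place: `HodgeCM/PerL34/P43_X1bridge.lean`, after `P43_forms.lean` (run 18) and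
`P43_KTypes.lean` (run 20).  KERNEL glue: the binder (X1) `ThetaPKilledByPminus` of N33b BY NAME from the Schur
vanishing of `P43_KTypes` + the Borel–Wallach `K`-type facts (PRINT, as hypotheses) + the DEFINITIONAL dictionary
"the `𝔭₋`-derivative of `u_{θ(φ)}` factors through the `K`-equivariant action map".  Nothing cited, nothing asserted.
-/
import Summits.HodgeConjecture.HodgeCM.PerL34.P43_forms
import Summits.HodgeConjecture.HodgeCM.PerL34.P43_KTypes

/-!
# N33b (X1) by name: `ThetaPKilledByPminus` from the `K`-type vanishing

`P43_KTypes.lean` kernel-checks the ALGEBRA of tex ll. 650–652 ("`(f¹,f²)` is annihilated by `𝔭₋`: the closure of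
`Θ_i(χ'_i)` is a sum of irreducibles with archimedean component `J⁺ ⊠ 𝟏`, and `𝔭₊` is the lowest `K_{ι₁}`-type of
`J⁺`") for ONE irreducible constituent: a `K`-map out of `P ≅ F_{0,0} ⊕ F_{1,1}` into `J⁺` is zero.  This file
(a) extends it to the SPAN (tex l. 651: `Θ_i(χ'_i)` is a sum of many constituents, so `𝔭₋ ⊗ Θ_i(χ'_i)[𝔭₊]` is
    GENERATED by copies of `F_{0,0}` and `F_{1,1}` rather than isomorphic to one copy of each):
    `map_eq_zero_of_generated` — a module map out of a module generated by images of simple modules, none of which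
    embeds into the target, is zero;
(b) plugs it into the N33b shell: `thetaPKilledByPminus_of_KTypes` — (X1) holds as soon as
    * `hgen`  : `P` (= `𝔭₋ ⊗ Θ_i(χ'_i)[𝔭₊]`, diagonal `K`-action) is generated by images of `M₀ = F_{0,0}` and
                `M₁ = F_{1,1}` — PRINT [BW VI 4.9 (1),(2)] (`𝔭₋ ⊗ 𝔭₊ ≅ Λ^{1,1} = F_{0,0} ⊕ F_{1,1}`) + complete
                reducibility of the compact group `K_{ι₁}`;
    * `h₀ h₁` : neither `F_{0,0}` nor `F_{1,1}` embeds into `N` (= the `(𝔤,K)`-module generated by `Θ_i(χ'_i)`) —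
                PRINT [BW VI 4.11/(9)] ("`J_{i,j}` contains `F_{i,j}` and no other `F_{p,q}`") for each constituent
                + INPUT N31 (every constituent has archimedean component `J⁺ = J_{1,0}`);
    * `act`   : the `K`-equivariant action map `x̄ ⊗ f ↦ x̄·f : P → N` (standard);
    * `hdict` : DEFINITIONAL dictionary — for `X = R(x̄) ∈ Pminus` and `φ` of type `𝔭₊ ⊠ 𝟏`, the derivative
                `X u_{θ(φ)}` is the image under an additive "slice/packaging" map `ι` of `act p` for some `p ∈ P`
                (namely `p = Σ_j x̄ ⊗ f^j`, `f = θ(φ,χ'_i)`; tex l. 652–654: `R(𝔭₋)` acts through the `ι₁`-variable);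
    * `hCoch` : DEFINITIONAL — `u_{θ(φ)}` is a `(1,0)`-cochain (type `𝔭₊`, Frobenius reciprocity; smooth).
So in `P43Bridge.N33b_lineSpans` / `groupInputs_of_N33b` the binder `hX1` is KERNEL(Schur) + PRINT(BW VI 4.9, 4.11)
+ INPUT(N31) + DEFINITIONAL(dictionary), each entering BY NAME.
-/

set_option autoImplicit false

namespace HodgeCM
namespace PerL34
namespace P43X1Bridge

open P43KTypes

section Generated

variable {R : Type*} [Ring R]
variable {M₀ M₁ N P : Type*} [AddCommGroup M₀] [Module R M₀] [AddCommGroup M₁] [Module R M₁]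
  [AddCommGroup N] [Module R N] [AddCommGroup P] [Module R P]

/-- The submodule of `P` generated by the images of all `R`-linear maps `M → P` (the `M`-isotypic part when `M` is
simple and `P` semisimple). -/
def generatedBy (R M P : Type*) [Ring R] [AddCommGroup M] [Module R M] [AddCommGroup P] [Module R P] :
    Submodule R P :=
  ⨆ f : M →ₗ[R] P, LinearMap.range f

/-- (Ported verbatim from the HodgeCMPerL package; no docstring in the source.) -/
theorem map_generatedBy_eq_bot [IsSimpleModule R M₀] (h₀ : NoEmbedding R M₀ N) (act : P →ₗ[R] N) :
    (generatedBy R M₀ P).map act = ⊥ := by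
  unfold generatedBy
  rw [Submodule.map_iSup, iSup_eq_bot]
  intro f
  rw [← LinearMap.range_comp, eq_zero_of_simple h₀ (act.comp f), LinearMap.range_zero]

/-- **Schur vanishing for the span.**  If `P` is generated by images of the simple modules `M₀` and `M₁`
(`generatedBy R M₀ P ⊔ generatedBy R M₁ P = ⊤`) and neither embeds into `N`, every `R`-linear `P → N` is zero. -/
theorem map_eq_zero_of_generated [IsSimpleModule R M₀] [IsSimpleModule R M₁] (h₀ : NoEmbedding R M₀ N)
    (h₁ : NoEmbedding R M₁ N) (hgen : generatedBy R M₀ P ⊔ generatedBy R M₁ P = ⊤) (act : P →ₗ[R] N) :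
    act = 0 := by
  have hmap : (⊤ : Submodule R P).map act = ⊥ := by
    rw [← hgen, Submodule.map_sup, map_generatedBy_eq_bot h₀, map_generatedBy_eq_bot h₁, bot_sup_eq]
  ext p
  have hp : act p ∈ (⊤ : Submodule R P).map act := ⟨p, trivial, rfl⟩
  rw [hmap, Submodule.mem_bot] at hp
  simpa using hp

end Generated

section N33b

variable {Ginf Gc Gf V S : Type*} [Group Gc] [Group Gf] [AddCommGroup V] [Module ℂ V]
  [AddCommGroup S] [Module ℂ S]
  (D : P43Forms.FormsDictionary Ginf V) (M : P43Forms.ThetaKernelData Ginf Gc Gf V S)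

/-- **(X1) `ThetaPKilledByPminus` BY NAME** from the `K`-type data (see the module docstring for the meaning and the
label of each hypothesis). -/
theorem thetaPKilledByPminus_of_KTypes {R : Type*} [Ring R] {M₀ M₁ N P : Type*} [AddCommGroup M₀] [Module R M₀]
    [AddCommGroup M₁] [Module R M₁] [AddCommGroup N] [Module R N] [AddCommGroup P] [Module R P]
    [IsSimpleModule R M₀] [IsSimpleModule R M₁]
    (h₀ : NoEmbedding R M₀ N) (h₁ : NoEmbedding R M₁ N) (hgen : generatedBy R M₀ P ⊔ generatedBy R M₁ P = ⊤)
    (act : P →ₗ[R] N) (ι : N →+ (Ginf → V))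
    (hdict : ∀ X ∈ D.Pminus, ∀ φ ∈ M.Ptype, ∃ p : P, X (P43Forms.uEval (M.theta φ)) = ι (act p))
    (hCoch : ∀ φ ∈ M.Ptype, P43Forms.uEval (M.theta φ) ∈ D.Cochain) :
    P43Forms.ThetaPKilledByPminus D M := by
  have hact : act = 0 := map_eq_zero_of_generated h₀ h₁ hgen act
  intro F hF
  obtain ⟨φ, hφ, rfl⟩ := hF
  refine ⟨hCoch φ hφ, fun X hX => ?_⟩
  obtain ⟨p, hp⟩ := hdict X hX φ hφ
  rw [hp, hact, LinearMap.zero_apply, map_zero]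

end N33b

end P43X1Bridge
end PerL34
end HodgeCM
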